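import Summits.BirchSwinnertonDyer.BirchSwinnertonDyer.Theorems.ByReductionTypeAtTwoFineSelmerConjAAtTwoAdditivePotGoodNarrowDefectCertificate1257Embeddings
import HarnessLib

/-!
# Route `ByReductionTypeAtTwo` (rung K4), crux C1″ `FineSelmerConjAAtTwoAdditivePotGood` (item stmt-BirchSwinnertonDyer-22615):
# THE NARROW-DEFECT CERTIFICATE FOR `d = 1257`, LAYER `1`, PART B — `#(U⁺/U²)(ℚ(θ) ⊔ ℚ_1) = 2` for `ℚ(θ, √2)`, `θ³ = θ² + 14θ + 15` (KERNEL)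
# (a `--supports 22615` file; seat `bsd-2adic-k4-w1` GEN 9; sequel of `…NarrowDefectCertificate1257Embeddings`; the hypothesis `hδ` of the
# narrow-defect door for the census row `100560c1`)

HONEST FRAMING (cell `bsd-2adic`, D-0036/D-0054/D-0152): KERNEL theorems about ONE totally real sextic field `A = ℚ(θ) ⊔ ℚ_1 = ℚ(θ, √2)`;
no elliptic curve, no named fact, no `sorry`. Closes nothing at the `∀`-level; nothing booked; BSD is not proved by any of this.

THE CERTIFICATE (`b = θ`, `s = √2`; units found by a local search, verified EXACTLY): the five units `−1`, `1 + s`, `2 + b`,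
`e₄ = (b² + b − 1) − (4 + 3b)s`, `e₅ = −(4 + 3b) − (3 + 2b)s` have, at the five real embeddings `(r₀, +√2)`, `(r₀, −√2)`, `(r₁, +√2)`,
`(r₁, −√2)`, `(r₂, +√2)` (`r₀ ≈ −2.2582`, `r₁ ≈ −1.4199`, `r₂ ≈ 4.6781`; part A `exists_ringHom_sup_layer_one_d1257`), the sign matrix
`[[1,1,1,1,1],[0,1,0,1,0],[1,1,0,0,0],[0,1,1,1,0],[0,0,0,0,1]]`, INVERTIBLE over `𝔽₂` ⟹ `#sign(U) ≥ 2⁵`; `b² − 2` is totally positive and not the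
square of a unit (part A) ⟹ `#(U⁺/U²) ≥ 2`; with `#(U⁺/U²)·#sign(U) = 2⁶`: **`#(U⁺/U²)(ℚ(θ, √2)) = 2`** = `#(U⁺/U²)(ℚ(θ))` (layer `0` file).
Matches the kit record of addL2x GEN 8 («CERT F3(i) n0=0»: `2`-ranks of `Cl(ℚ(P,i))`, `Cl(ℚ(P,ζ₈))` both `1`), now KERNEL.

References: [FrohlichTaylor1990] Ch. V §1 (1.10)–(1.13); [Cohen1993] §4.1.3, App. B (d = 1257); [Washington1997] §13.1 (`ℚ_1 = ℚ(√2)`).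
-/

set_option autoImplicit false
-- sibling precedent: the directory name repeats the summit name
set_option linter.dupNamespace false

noncomputable section

open scoped Classical IntermediateField NumberField

namespace Summit.BirchSwinnertonDyer.BirchSwinnertonDyer.Theorems.AddKatoTwo

open Polynomial IsDedekindDomain NumberField Field IntermediateField
  Literature.NumberTheory.EllipticCurves Literature.NumberTheory.IwasawaTheory Literature.NumberTheory.NumberFields
  Literature.Geometry.Kaehler.ComplexTorus

variable {θ : AlgebraicClosure ℚ}

set_option maxHeartbeats 800000 in
/-- **`#(U⁺/U²)(ℚ(θ) ⊔ ℚ_1) = 2` for `θ³ − θ² − 14θ − 15 = 0`** (`ℚ(θ, √2)`, totally real sextic, narrow defect `1`), KERNEL — the layer-`1`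
half of the narrow-defect certificate of the census row `100560c1` (five units with an invertible sign matrix at five real embeddings,
and the non-square totally positive unit `b² − 2`; see the module docstring).
[cite: FrohlichTaylor1990, Ch. V §1 (1.12)–(1.13), p. 164] [cite: Cohen1993, §4.1.3 and App. B (d = 1257)] [cite: Washington1997, §13.1] -/
theorem card_totPosUnitsModSq_adjoin_sup_layer_one_d1257
    (hθ : aeval θ (Cubic.toPoly ⟨1, ((-1 : ℤ) : ℚ), ((-14 : ℤ) : ℚ), ((-15 : ℤ) : ℚ)⟩) = 0) :
    haveI : FiniteDimensional ℚ ↥ℚ⟮θ⟯ :=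
      IntermediateField.adjoin.finiteDimensional ⟨_, Cubic.monic_of_a_eq_one', by rwa [← aeval_def]⟩
    haveI : FiniteDimensional ℚ ↥((CyclotomicZp.zpExtension 2).layer 1) := (CyclotomicZp.zpExtension 2).finiteDimensional_layer_holds 1
    haveI : NumberField ↥(ℚ⟮θ⟯ ⊔ (CyclotomicZp.zpExtension 2).layer 1) := NumberField.mk
    Nat.card (TotPosUnitsModSq ↥(ℚ⟮θ⟯ ⊔ (CyclotomicZp.zpExtension 2).layer 1)) = 2 := by
  haveI : FiniteDimensional ℚ ↥ℚ⟮θ⟯ :=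
    IntermediateField.adjoin.finiteDimensional ⟨_, Cubic.monic_of_a_eq_one', by rwa [← aeval_def]⟩
  haveI : FiniteDimensional ℚ ↥((CyclotomicZp.zpExtension 2).layer 1) := (CyclotomicZp.zpExtension 2).finiteDimensional_layer_holds 1
  haveI : NumberField ↥ℚ⟮θ⟯ := NumberField.mk
  haveI : NumberField ↥(ℚ⟮θ⟯ ⊔ (CyclotomicZp.zpExtension 2).layer 1) := NumberField.mk
  obtain ⟨hreal, hfinA, h3⟩ := layer_one_basics_d1257 hθ
  haveI := hreal
  obtain ⟨t, ht, ht2⟩ := CyclotomicZp.exists_mem_layer_one_sq_eq_two_zpExtension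
  have hKA : ℚ⟮θ⟯ ≤ ℚ⟮θ⟯ ⊔ (CyclotomicZp.zpExtension 2).layer 1 := le_sup_left
  have htA : t ∈ ℚ⟮θ⟯ ⊔ (CyclotomicZp.zpExtension 2).layer 1 := (le_sup_right : (CyclotomicZp.zpExtension 2).layer 1 ≤ _) ht
  set t' : ↥(ℚ⟮θ⟯ ⊔ (CyclotomicZp.zpExtension 2).layer 1) := ⟨t, htA⟩ with ht'def
  have ht'2 : t' ^ 2 = 2 := by
    apply (algebraMap ↥(ℚ⟮θ⟯ ⊔ (CyclotomicZp.zpExtension 2).layer 1) (AlgebraicClosure ℚ)).injective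
    rw [map_pow, map_ofNat]
    exact ht2
  set θ' : ↥(ℚ⟮θ⟯ ⊔ (CyclotomicZp.zpExtension 2).layer 1) := inclusion hKA (AdjoinSimple.gen ℚ θ) with hθ'def
  -- the five embeddings `(r₀,+), (r₀,−), (r₁,+), (r₁,−), (r₂,+)`
  obtain ⟨ρ₀, ρ₁, ρ₂, x₀, x₁, x₂, hρ₀, hρ₁, hρ₂, hl₀, hu₀, hl₁, hu₁, hl₂, hu₂⟩ := exists_three_ringHom_adjoin_d1257 hθ
  obtain ⟨hs2l, hs2u⟩ := sqrt_two_bounds'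
  obtain ⟨σ₀, hσ₀K, hσ₀t⟩ := exists_ringHom_sup_layer_one_d1257 hθ ht ht2 ρ₀ (Real.sqrt 2) (Or.inl rfl)
  obtain ⟨σ₁, hσ₁K, hσ₁t⟩ := exists_ringHom_sup_layer_one_d1257 hθ ht ht2 ρ₀ (-Real.sqrt 2) (Or.inr rfl)
  obtain ⟨σ₂, hσ₂K, hσ₂t⟩ := exists_ringHom_sup_layer_one_d1257 hθ ht ht2 ρ₁ (Real.sqrt 2) (Or.inl rfl)
  obtain ⟨σ₃, hσ₃K, hσ₃t⟩ := exists_ringHom_sup_layer_one_d1257 hθ ht ht2 ρ₁ (-Real.sqrt 2) (Or.inr rfl)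
  obtain ⟨σ₄, hσ₄K, hσ₄t⟩ := exists_ringHom_sup_layer_one_d1257 hθ ht ht2 ρ₂ (Real.sqrt 2) (Or.inl rfl)
  have hσ₀θ : σ₀ θ' = x₀ := by rw [hθ'def, hσ₀K, hρ₀]
  have hσ₁θ : σ₁ θ' = x₀ := by rw [hθ'def, hσ₁K, hρ₀]
  have hσ₂θ : σ₂ θ' = x₁ := by rw [hθ'def, hσ₂K, hρ₁]
  have hσ₃θ : σ₃ θ' = x₁ := by rw [hθ'def, hσ₃K, hρ₁]
  have hσ₄θ : σ₄ θ' = x₂ := by rw [hθ'def, hσ₄K, hρ₂]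
  -- integers `bA = θ`, `sA = √2`
  letI : Algebra ↥ℚ⟮θ⟯ ↥(ℚ⟮θ⟯ ⊔ (CyclotomicZp.zpExtension 2).layer 1) := (inclusion hKA).toRingHom.toAlgebra
  obtain ⟨b, hbθ, hb⟩ := exists_ringOfIntegers_cubic_root (p := -1) (q := -14) (r := -15) hθ
  have hb' : b ^ 3 - b ^ 2 - 14 * b - 15 = 0 := by push_cast at hb; linear_combination hb
  set bA : 𝓞 ↥(ℚ⟮θ⟯ ⊔ (CyclotomicZp.zpExtension 2).layer 1) := algebraMap (𝓞 ↥ℚ⟮θ⟯) (𝓞 ↥(ℚ⟮θ⟯ ⊔ (CyclotomicZp.zpExtension 2).layer 1)) b with hbAdef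
  have hbA' : bA ^ 3 - bA ^ 2 - 14 * bA - 15 = 0 := by
    have h := congrArg (algebraMap (𝓞 ↥ℚ⟮θ⟯) (𝓞 ↥(ℚ⟮θ⟯ ⊔ (CyclotomicZp.zpExtension 2).layer 1))) hb'
    simp only [map_sub, map_mul, map_pow, map_ofNat, map_zero] at h
    exact h
  have hbgen : (b : ↥ℚ⟮θ⟯) = AdjoinSimple.gen ℚ θ := Subtype.ext hbθ
  have hbgen' : algebraMap (𝓞 ↥ℚ⟮θ⟯) ↥ℚ⟮θ⟯ b = AdjoinSimple.gen ℚ θ := Subtype.ext hbθ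
  have hbAval : ((bA : 𝓞 ↥(ℚ⟮θ⟯ ⊔ (CyclotomicZp.zpExtension 2).layer 1)) : ↥(ℚ⟮θ⟯ ⊔ (CyclotomicZp.zpExtension 2).layer 1)) = θ' := by
    rw [hbAdef, hθ'def]
    change ((RingOfIntegers.mapRingHom (algebraMap ↥ℚ⟮θ⟯ ↥(ℚ⟮θ⟯ ⊔ (CyclotomicZp.zpExtension 2).layer 1)) b : 𝓞 ↥(ℚ⟮θ⟯ ⊔ (CyclotomicZp.zpExtension 2).layer 1)) : ↥(ℚ⟮θ⟯ ⊔ (CyclotomicZp.zpExtension 2).layer 1)) = _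
    rw [RingOfIntegers.mapRingHom_apply, hbgen]; rfl
  have hbAval' : algebraMap (𝓞 ↥(ℚ⟮θ⟯ ⊔ (CyclotomicZp.zpExtension 2).layer 1)) ↥(ℚ⟮θ⟯ ⊔ (CyclotomicZp.zpExtension 2).layer 1) bA = θ' := by
    rw [← NumberField.RingOfIntegers.coe_eq_algebraMap]; exact hbAval
  have hsint : IsIntegral ℤ t' := ⟨X ^ 2 - C 2, monic_X_pow_sub_C _ two_ne_zero, by simp [ht'2]⟩
  set sA : 𝓞 ↥(ℚ⟮θ⟯ ⊔ (CyclotomicZp.zpExtension 2).layer 1) := ⟨t', hsint⟩ with hsAdef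
  have hsAval : ((sA : 𝓞 ↥(ℚ⟮θ⟯ ⊔ (CyclotomicZp.zpExtension 2).layer 1)) : ↥(ℚ⟮θ⟯ ⊔ (CyclotomicZp.zpExtension 2).layer 1)) = t' := rfl
  have hsAval' : algebraMap (𝓞 ↥(ℚ⟮θ⟯ ⊔ (CyclotomicZp.zpExtension 2).layer 1)) ↥(ℚ⟮θ⟯ ⊔ (CyclotomicZp.zpExtension 2).layer 1) sA = t' := by
    rw [← NumberField.RingOfIntegers.coe_eq_algebraMap]; exact hsAval
  have hsA2 : sA ^ 2 = 2 := by
    apply IsFractionRing.injective (𝓞 ↥(ℚ⟮θ⟯ ⊔ (CyclotomicZp.zpExtension 2).layer 1)) ↥(ℚ⟮θ⟯ ⊔ (CyclotomicZp.zpExtension 2).layer 1)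
    rw [map_pow, map_ofNat, hsAval', ht'2]
  -- the five units
  obtain ⟨hid₁, hid₂, hid₄, hid₅, hidp⟩ := unit_ids_d1257 bA sA hbA' hsA2
  set e₁ : (𝓞 ↥(ℚ⟮θ⟯ ⊔ (CyclotomicZp.zpExtension 2).layer 1))ˣ := Units.mkOfMulEqOne _ _ hid₁ with he₁def
  set e₂ : (𝓞 ↥(ℚ⟮θ⟯ ⊔ (CyclotomicZp.zpExtension 2).layer 1))ˣ := Units.mkOfMulEqOne _ _ hid₂ with he₂def
  set e₄ : (𝓞 ↥(ℚ⟮θ⟯ ⊔ (CyclotomicZp.zpExtension 2).layer 1))ˣ := Units.mkOfMulEqOne _ _ hid₄ with he₄def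
  set e₅ : (𝓞 ↥(ℚ⟮θ⟯ ⊔ (CyclotomicZp.zpExtension 2).layer 1))ˣ := Units.mkOfMulEqOne _ _ hid₅ with he₅def
  -- their values under an embedding `σ` with `σ θ' = x`, `σ t' = y`
  have hv₁ : ∀ (σ : ↥(ℚ⟮θ⟯ ⊔ (CyclotomicZp.zpExtension 2).layer 1) →+* ℝ) (y : ℝ), σ t' = y → σ ((e₁ : 𝓞 ↥(ℚ⟮θ⟯ ⊔ (CyclotomicZp.zpExtension 2).layer 1)) : ↥(ℚ⟮θ⟯ ⊔ (CyclotomicZp.zpExtension 2).layer 1)) = 1 + y := by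
    intro σ y hy
    rw [he₁def, Units.val_mkOfMulEqOne, NumberField.RingOfIntegers.coe_eq_algebraMap]
    simp only [map_add, map_one, hsAval', hy]
  have hv₂ : ∀ (σ : ↥(ℚ⟮θ⟯ ⊔ (CyclotomicZp.zpExtension 2).layer 1) →+* ℝ) (x : ℝ), σ θ' = x → σ ((e₂ : 𝓞 ↥(ℚ⟮θ⟯ ⊔ (CyclotomicZp.zpExtension 2).layer 1)) : ↥(ℚ⟮θ⟯ ⊔ (CyclotomicZp.zpExtension 2).layer 1)) = 2 + x := by
    intro σ x hx
    rw [he₂def, Units.val_mkOfMulEqOne, NumberField.RingOfIntegers.coe_eq_algebraMap]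
    simp only [map_add, map_ofNat, hbAval', hx]
  have hv₄ : ∀ (σ : ↥(ℚ⟮θ⟯ ⊔ (CyclotomicZp.zpExtension 2).layer 1) →+* ℝ) (x y : ℝ), σ θ' = x → σ t' = y →
      σ ((e₄ : 𝓞 ↥(ℚ⟮θ⟯ ⊔ (CyclotomicZp.zpExtension 2).layer 1)) : ↥(ℚ⟮θ⟯ ⊔ (CyclotomicZp.zpExtension 2).layer 1)) = -1 - 4 * y + x - 3 * x * y + x ^ 2 := by
    intro σ x y hx hy
    rw [he₄def, Units.val_mkOfMulEqOne, NumberField.RingOfIntegers.coe_eq_algebraMap]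
    simp only [map_add, map_sub, map_mul, map_pow, map_neg, map_one, map_ofNat, hbAval', hsAval', hx, hy]
  have hv₅ : ∀ (σ : ↥(ℚ⟮θ⟯ ⊔ (CyclotomicZp.zpExtension 2).layer 1) →+* ℝ) (x y : ℝ), σ θ' = x → σ t' = y →
      σ ((e₅ : 𝓞 ↥(ℚ⟮θ⟯ ⊔ (CyclotomicZp.zpExtension 2).layer 1)) : ↥(ℚ⟮θ⟯ ⊔ (CyclotomicZp.zpExtension 2).layer 1)) = -4 - 3 * y - 3 * x - 2 * x * y := by
    intro σ x y hx hy
    rw [he₅def, Units.val_mkOfMulEqOne, NumberField.RingOfIntegers.coe_eq_algebraMap]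
    simp only [map_sub, map_mul, map_neg, map_ofNat, hbAval', hsAval', hx, hy]
  -- sign bits
  have sneg : ∀ (σ : ↥(ℚ⟮θ⟯ ⊔ (CyclotomicZp.zpExtension 2).layer 1) →+* ℝ) (e : (𝓞 ↥(ℚ⟮θ⟯ ⊔ (CyclotomicZp.zpExtension 2).layer 1))ˣ), σ ((e : 𝓞 ↥(ℚ⟮θ⟯ ⊔ (CyclotomicZp.zpExtension 2).layer 1)) : ↥(ℚ⟮θ⟯ ⊔ (CyclotomicZp.zpExtension 2).layer 1)) < 0 → signVec e σ = 1 :=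
    fun σ e h => by rw [signVec_apply, if_pos h]
  have spos : ∀ (σ : ↥(ℚ⟮θ⟯ ⊔ (CyclotomicZp.zpExtension 2).layer 1) →+* ℝ) (e : (𝓞 ↥(ℚ⟮θ⟯ ⊔ (CyclotomicZp.zpExtension 2).layer 1))ˣ), 0 < σ ((e : 𝓞 ↥(ℚ⟮θ⟯ ⊔ (CyclotomicZp.zpExtension 2).layer 1)) : ↥(ℚ⟮θ⟯ ⊔ (CyclotomicZp.zpExtension 2).layer 1)) → signVec e σ = 0 :=
    fun σ e h => by rw [signVec_apply, if_neg (not_lt.mpr h.le)]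
  have hM : ∀ i j, signVec (![-1, e₁, e₂, e₄, e₅] i) (![σ₀, σ₁, σ₂, σ₃, σ₄] j) =
      !![(1 : ZMod 2), 1, 1, 1, 1; 0, 1, 0, 1, 0; 1, 1, 0, 0, 0; 0, 1, 1, 1, 0; 0, 0, 0, 0, 1] i j := by
    intro i j
    fin_cases i
    · fin_cases j <;> (show signVec (-1) _ = 1) <;> rw [signVec_neg_one]
    · fin_cases j
      · show signVec e₁ σ₀ = 0; exact spos _ _ (by rw [hv₁ σ₀ _ hσ₀t]; linarith)
      · show signVec e₁ σ₁ = 1; exact sneg _ _ (by rw [hv₁ σ₁ _ hσ₁t]; linarith)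
      · show signVec e₁ σ₂ = 0; exact spos _ _ (by rw [hv₁ σ₂ _ hσ₂t]; linarith)
      · show signVec e₁ σ₃ = 1; exact sneg _ _ (by rw [hv₁ σ₃ _ hσ₃t]; linarith)
      · show signVec e₁ σ₄ = 0; exact spos _ _ (by rw [hv₁ σ₄ _ hσ₄t]; linarith)
    · fin_cases j
      · show signVec e₂ σ₀ = 1; exact sneg _ _ (by rw [hv₂ σ₀ _ hσ₀θ]; linarith)
      · show signVec e₂ σ₁ = 1; exact sneg _ _ (by rw [hv₂ σ₁ _ hσ₁θ]; linarith)
      · show signVec e₂ σ₂ = 0; exact spos _ _ (by rw [hv₂ σ₂ _ hσ₂θ]; linarith)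
      · show signVec e₂ σ₃ = 0; exact spos _ _ (by rw [hv₂ σ₃ _ hσ₃θ]; linarith)
      · show signVec e₂ σ₄ = 0; exact spos _ _ (by rw [hv₂ σ₄ _ hσ₄θ]; linarith)
    · fin_cases j
      · show signVec e₄ σ₀ = 0; exact spos _ _ (by rw [hv₄ σ₀ _ _ hσ₀θ hσ₀t]; nlinarith)
      · show signVec e₄ σ₁ = 1; exact sneg _ _ (by rw [hv₄ σ₁ _ _ hσ₁θ hσ₁t]; nlinarith)
      · show signVec e₄ σ₂ = 1; exact sneg _ _ (by rw [hv₄ σ₂ _ _ hσ₂θ hσ₂t]; nlinarith)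
      · show signVec e₄ σ₃ = 1; exact sneg _ _ (by rw [hv₄ σ₃ _ _ hσ₃θ hσ₃t]; nlinarith)
      · show signVec e₄ σ₄ = 0; exact spos _ _ (by rw [hv₄ σ₄ _ _ hσ₄θ hσ₄t]; nlinarith)
    · fin_cases j
      · show signVec e₅ σ₀ = 0; exact spos _ _ (by rw [hv₅ σ₀ _ _ hσ₀θ hσ₀t]; nlinarith)
      · show signVec e₅ σ₁ = 0; exact spos _ _ (by rw [hv₅ σ₁ _ _ hσ₁θ hσ₁t]; nlinarith)
      · show signVec e₅ σ₂ = 0; exact spos _ _ (by rw [hv₅ σ₂ _ _ hσ₂θ hσ₂t]; nlinarith)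
      · show signVec e₅ σ₃ = 0; exact spos _ _ (by rw [hv₅ σ₃ _ _ hσ₃θ hσ₃t]; nlinarith)
      · show signVec e₅ σ₄ = 1; exact sneg _ _ (by rw [hv₅ σ₄ _ _ hσ₄θ hσ₄t]; nlinarith)
  have hMunit : IsUnit (!![(1 : ZMod 2), 1, 1, 1, 1; 0, 1, 0, 1, 0; 1, 1, 0, 0, 0; 0, 1, 1, 1, 0; 0, 0, 0, 0, 1]) := by
    haveI := invertibleOfRightInverse
      (!![(1 : ZMod 2), 1, 1, 1, 1; 0, 1, 0, 1, 0; 1, 1, 0, 0, 0; 0, 1, 1, 1, 0; 0, 0, 0, 0, 1])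
      !![(1 : ZMod 2), 0, 0, 1, 1; 1, 0, 1, 1, 1; 0, 1, 0, 1, 0; 1, 1, 1, 1, 1; 0, 0, 0, 0, 1] (by decide)
    exact isUnit_of_invertible _
  have hsig := two_pow_le_card_range_signVec ![-1, e₁, e₂, e₄, e₅] ![σ₀, σ₁, σ₂, σ₃, σ₄] _ hM hMunit
  -- the totally positive non-square `b² − 2`
  set eA : (𝓞 ↥(ℚ⟮θ⟯ ⊔ (CyclotomicZp.zpExtension 2).layer 1))ˣ := Units.mkOfMulEqOne _ _ hidp with heAdef
  have heAval : ((eA : 𝓞 ↥(ℚ⟮θ⟯ ⊔ (CyclotomicZp.zpExtension 2).layer 1)) : ↥(ℚ⟮θ⟯ ⊔ (CyclotomicZp.zpExtension 2).layer 1)) = inclusion hKA (((b ^ 2 - 2 : 𝓞 ↥ℚ⟮θ⟯)) : ↥ℚ⟮θ⟯) := by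
    rw [heAdef, Units.val_mkOfMulEqOne, NumberField.RingOfIntegers.coe_eq_algebraMap, map_sub, map_pow, map_ofNat, hbAval',
      hθ'def, NumberField.RingOfIntegers.coe_eq_algebraMap, map_sub, map_pow, map_ofNat, hbgen', map_sub, map_pow, map_ofNat]
  have hpos : ∀ σ : ↥(ℚ⟮θ⟯ ⊔ (CyclotomicZp.zpExtension 2).layer 1) →+* ℝ, 0 < σ ((eA : 𝓞 ↥(ℚ⟮θ⟯ ⊔ (CyclotomicZp.zpExtension 2).layer 1)) : ↥(ℚ⟮θ⟯ ⊔ (CyclotomicZp.zpExtension 2).layer 1)) := fun σ => by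
    rw [heAval, show σ (inclusion hKA (((b ^ 2 - 2 : 𝓞 ↥ℚ⟮θ⟯)) : ↥ℚ⟮θ⟯)) =
      (σ.comp (inclusion hKA).toRingHom) (((b ^ 2 - 2 : 𝓞 ↥ℚ⟮θ⟯)) : ↥ℚ⟮θ⟯) from rfl]
    exact totallyPositive_sq_sub_two_d1257 b hb _
  have hns := not_exists_sq_eq_sq_sub_two_sup_layer_one_d1257 hθ ht ht2 b hb eA heAval
  have htwo := two_le_card_totPosUnitsModSq_of_not_sq eA hpos hns
  exact card_totPosUnitsModSq_eq_two_of_bounds (n := 5) hfinA hsig htwo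

/-- **The narrow defects of layers `0` and `1` agree for `d = 1257`**: `#(U⁺/U²)(ℚ(θ) ⊔ ℚ_1) = #(U⁺/U²)(ℚ(θ))` (`= 2`) — the hypothesis
`hδ` of the narrow-defect door `conjA_two_of_adjoin_root_of_card_totPosUnitsModSq_layer_one_eq` for the row `100560c1`.
[cite: Cohen1993, App. B (d = 1257)] [cite: FrohlichTaylor1990, Ch. V §1 (1.12), p. 164] -/
theorem card_totPosUnitsModSq_layer_one_eq_d1257
    (hθ : aeval θ (Cubic.toPoly ⟨1, ((-1 : ℤ) : ℚ), ((-14 : ℤ) : ℚ), ((-15 : ℤ) : ℚ)⟩) = 0) :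
    haveI : FiniteDimensional ℚ ↥ℚ⟮θ⟯ :=
      IntermediateField.adjoin.finiteDimensional ⟨_, Cubic.monic_of_a_eq_one', by rwa [← aeval_def]⟩
    haveI : FiniteDimensional ℚ ↥((CyclotomicZp.zpExtension 2).layer 1) := (CyclotomicZp.zpExtension 2).finiteDimensional_layer_holds 1
    haveI : NumberField ↥(ℚ⟮θ⟯ ⊔ (CyclotomicZp.zpExtension 2).layer 1) := NumberField.mk
    haveI : NumberField ↥ℚ⟮θ⟯ := NumberField.mk
    Nat.card (TotPosUnitsModSq ↥(ℚ⟮θ⟯ ⊔ (CyclotomicZp.zpExtension 2).layer 1)) = Nat.card (TotPosUnitsModSq ↥ℚ⟮θ⟯) := by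
  rw [card_totPosUnitsModSq_adjoin_sup_layer_one_d1257 hθ, card_totPosUnitsModSq_adjoin_d1257 hθ]

end Summit.BirchSwinnertonDyer.BirchSwinnertonDyer.Theorems.AddKatoTwo

end
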